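import Mathlib
import Literature.AlgebraicGeometry.Resolution.CobordantGame
import Summits.ResolutionOfSingularities.ResolutionOfSingularities.Theorems.WeightedInvariantLocalWeightedDropMonicPointBlowup
import Summits.ResolutionOfSingularities.ResolutionOfSingularities.Theorems.WeightedInvariantLocalWeightedDropInsepPointStep
import Summits.ResolutionOfSingularities.ResolutionOfSingularities.Theorems.WeightedInvariantLocalWeightedDropSurfaceGermsWon

/-!
# `WeightedInvariant.LocalWeightedDrop`: the NON-SQUARE TANGENT QUADRIC exit, unconditionally in four and five variables

Crux item stmt-ResolutionOfSingularities-8899 `LocalWeightedDrop` (route `ResolutionOfSingularities/WeightedInvariant`), skeleton v31 (four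
registered stubs, all in `N ≥ 4` variables, all with the hypothesis «the tangent quadric is the square of a linear form» at `d = 2`).
[OURS · L1 W4.3, chain w43, stub worker 4 (gen 4): the exit used at every non-terminal exceptional point of the `d = 2` reduction games,
packaged BY NAME now that the N = 3 layer is unconditional (`surfaceGermsWon`); NOT a statement of any manuscript.]

* `won_of_tangentQuadric_not_sq` (k̄, every dimension `n + 3`): a singular germ whose degree-2 part is NOT the square of a linear form is
  won, given the singular germs in `n + 1` variables — `stub_coneDichotomy` (square, or a hyperbolic pair after a coordinate change) +
  `TangentConeCut.hyperbolicStartsWon`;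
* `won_of_crossCoeff_ne_zero` (characteristic `2`): a non-zero CROSS coefficient `[x_i x_j] f` (`i ≠ j`) suffices (squares of linear forms
  have no cross terms in characteristic `2`, `InsepDoublePoint.coeff_cross_sq_linear_eq_zero`);
* `won_four_of_tangentQuadric_not_sq`, `won_four_of_crossCoeff_ne_zero` (N = 4, via `PlaneWon.lowStartsWon`) and
  `won_five_of_tangentQuadric_not_sq`, `won_five_of_crossCoeff_ne_zero` (N = 5, via `surfaceGermsWon`) — UNCONDITIONAL: in four and five
  variables over an algebraically closed field, every singular germ outside the «square tangent quadric» class of the v31 stubs is won.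
-/

set_option linter.dupNamespace false -- mandated namespace of this single-conjunct summit

namespace Summit.ResolutionOfSingularities.ResolutionOfSingularities.Theorems

open Literature.AlgebraicGeometry.Resolution
open Literature.AlgebraicGeometry.Resolution.CobordantGame

/-- **NON-SQUARE TANGENT QUADRIC ⇒ WON** (algebraically closed `k`, every dimension `n + 3`, given the singular germs in `n + 1` variables):
by the cone dichotomy the degree-2 part of a singular germ is either the square of a linear form or carries a hyperbolic pair after a legal
coordinate change, and hyperbolic starts are won. [OURS · L1 W4.3] -/
theorem won_of_tangentQuadric_not_sq {k : Type} [Field k] [IsAlgClosed k] {n : ℕ}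
    (hlow : ∀ g : MvPowerSeries (Fin (n + 1)) k, CobordantGame.IsSingular k g → CobordantGame.Won k (n + 1) g)
    (f : MvPowerSeries (Fin (n + 3)) k) (hf : CobordantGame.IsSingular k f)
    (hnsq : ¬ ∃ ℓ : Fin (n + 3) → k, ∀ i j : Fin (n + 3),
      MvPowerSeries.coeff (Finsupp.single i 1 + Finsupp.single j 1) f =
        MvPowerSeries.coeff (Finsupp.single i 1 + Finsupp.single j 1)
          ((∑ l, MvPowerSeries.C (ℓ l) * MvPowerSeries.X l) ^ 2)) :
    CobordantGame.Won k (n + 3) f := by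
  rcases stub_coneDichotomy k (n + 1) f hf with hhyp | hsq
  · exact TangentConeCut.hyperbolicStartsWon hlow f hf hhyp
  · exact absurd hsq hnsq

/-- **A NON-ZERO CROSS COEFFICIENT ⇒ WON** (characteristic `2`, algebraically closed `k`, every dimension `n + 3`, given the singular germs in
`n + 1` variables): squares of linear forms have no cross terms in characteristic `2`. [OURS · L1 W4.3] -/
theorem won_of_crossCoeff_ne_zero {k : Type} [Field k] [CharP k 2] [IsAlgClosed k] {n : ℕ}
    (hlow : ∀ g : MvPowerSeries (Fin (n + 1)) k, CobordantGame.IsSingular k g → CobordantGame.Won k (n + 1) g)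
    (f : MvPowerSeries (Fin (n + 3)) k) (hf : CobordantGame.IsSingular k f) {i j : Fin (n + 3)} (hij : i ≠ j)
    (h : MvPowerSeries.coeff (Finsupp.single i 1 + Finsupp.single j 1) f ≠ 0) :
    CobordantGame.Won k (n + 3) f :=
  won_of_tangentQuadric_not_sq hlow f hf fun ⟨ℓ, hℓ⟩ =>
    h (by rw [hℓ i j]; exact InsepDoublePoint.coeff_cross_sq_linear_eq_zero ℓ hij)

/-- N = 4, UNCONDITIONAL (algebraically closed `k`, any characteristic): a singular germ in four variables whose tangent quadric is not a
square is won (the plane germs are won, `PlaneWon.lowStartsWon`). -/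
theorem won_four_of_tangentQuadric_not_sq {k : Type} [Field k] [IsAlgClosed k]
    (f : MvPowerSeries (Fin 4) k) (hf : CobordantGame.IsSingular k f)
    (hnsq : ¬ ∃ ℓ : Fin 4 → k, ∀ i j : Fin 4,
      MvPowerSeries.coeff (Finsupp.single i 1 + Finsupp.single j 1) f =
        MvPowerSeries.coeff (Finsupp.single i 1 + Finsupp.single j 1)
          ((∑ l, MvPowerSeries.C (ℓ l) * MvPowerSeries.X l) ^ 2)) :
    CobordantGame.Won k 4 f :=
  won_of_tangentQuadric_not_sq (n := 1) (fun g hg => PlaneWon.lowStartsWon k le_rfl g hg) f hf hnsq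

/-- N = 4, characteristic `2`, UNCONDITIONAL: a non-zero cross coefficient wins. -/
theorem won_four_of_crossCoeff_ne_zero {k : Type} [Field k] [CharP k 2] [IsAlgClosed k]
    (f : MvPowerSeries (Fin 4) k) (hf : CobordantGame.IsSingular k f) {i j : Fin 4} (hij : i ≠ j)
    (h : MvPowerSeries.coeff (Finsupp.single i 1 + Finsupp.single j 1) f ≠ 0) : CobordantGame.Won k 4 f :=
  won_of_crossCoeff_ne_zero (n := 1) (fun g hg => PlaneWon.lowStartsWon k le_rfl g hg) f hf hij h

/-- N = 5, UNCONDITIONAL (algebraically closed `k` of characteristic `p`): a singular germ in five variables whose tangent quadric is not a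
square is won — the surface germs are won (`surfaceGermsWon`). -/
theorem won_five_of_tangentQuadric_not_sq (p : ℕ) (hp : p.Prime) {k : Type} [Field k] [CharP k p] [IsAlgClosed k]
    (f : MvPowerSeries (Fin 5) k) (hf : CobordantGame.IsSingular k f)
    (hnsq : ¬ ∃ ℓ : Fin 5 → k, ∀ i j : Fin 5,
      MvPowerSeries.coeff (Finsupp.single i 1 + Finsupp.single j 1) f =
        MvPowerSeries.coeff (Finsupp.single i 1 + Finsupp.single j 1)
          ((∑ l, MvPowerSeries.C (ℓ l) * MvPowerSeries.X l) ^ 2)) :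
    CobordantGame.Won k 5 f :=
  won_of_tangentQuadric_not_sq (n := 2) (surfaceGermsWon p hp k) f hf hnsq

/-- N = 5, characteristic `2`, UNCONDITIONAL: a non-zero cross coefficient wins (e.g. the «jumping» exceptional points of the wild
`d = 2` reduction game whose re-centred tangent quadric keeps a cross term). -/
theorem won_five_of_crossCoeff_ne_zero {k : Type} [Field k] [CharP k 2] [IsAlgClosed k]
    (f : MvPowerSeries (Fin 5) k) (hf : CobordantGame.IsSingular k f) {i j : Fin 5} (hij : i ≠ j)
    (h : MvPowerSeries.coeff (Finsupp.single i 1 + Finsupp.single j 1) f ≠ 0) : CobordantGame.Won k 5 f :=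
  won_of_crossCoeff_ne_zero (n := 2) (surfaceGermsWon 2 Nat.prime_two k) f hf hij h

end Summit.ResolutionOfSingularities.ResolutionOfSingularities.Theorems
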